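import Summits.BirchSwinnertonDyer.BirchSwinnertonDyer.Theorems.EisensteinPrimesMazurMCOnX1RankZeroInterludeRoadBReduction
import Summits.BirchSwinnertonDyer.BirchSwinnertonDyer.Theorems.EisensteinPrimesMazurMCOnX1RankZeroInterludeStubRoadBResidueP
import Summits.BirchSwinnertonDyer.BirchSwinnertonDyer.Theorems.EisensteinPrimesMazurMCOnX1RankZeroInterludeResidualGL1Tame
import Summits.BirchSwinnertonDyer.BirchSwinnertonDyer.Theorems.EisensteinPrimesMazurMCOnX1RankZeroInterludeResidualGL1Unr
import Summits.BirchSwinnertonDyer.BirchSwinnertonDyer.Theorems.EisensteinPrimesMazurMCOnX1RankZeroInterludeResidualGL1EvenOfFW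
import Literature.NumberTheory.IwasawaTheory.ClassicalMuVanishesUnramifiedClassesProofs
import HarnessLib

/-!
# Crux `MazurMCOnX1RankZero` (item stmt-BirchSwinnertonDyer-19035), line `interlude_with_torsion`: ROAD B END TO END —
# K2⁺ (cyclotomic isogeny invariance of `char 𝔛_Gr(·/K_∞⁺)` at an odd good prime) FROM THE FERRERO–WASHINGTON THEOREM ALONE

Cell `bsd-eis` (host `run/shared/lean/pub/bsd-eis/`), seat `bsd-eis-lam-a` g21 (PART 1b seat (4); `--supports`
stmt-BirchSwinnertonDyer-19035 as a HELPER; no claim, closes nothing by itself).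

The line's currency K2⁺ = `…Theorems.InterludeWithTorsion.XGrCharIdealIsogenyInvariantCyc` (`…InterludeDefs`, p685554) — for rationally
isogenous `W₁ ∼ W₂` with good reduction at an odd `p` split in an admissible imaginary quadratic `K`, over the CYCLOTOMIC `ℤ_p`-extension
of `K`: `𝔛_Gr(W₂/K_∞⁺)` (relaxed at `v`, strict at `v̄`) is `Λ`-torsion once `𝔛_Gr(W₁/K_∞⁺)` is, with the SAME characteristic ideal — is
Perrin-Riou's `μ`-formula specialised to the Greenberg structure (Perrin-Riou, ASPM 17 (1989), Théorème p. 349; Kobayashi–Ota, ASPM 86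
(2020), proof of Prop. 2.9). Its typing as a Literature named fact was REFUSED (p617858, «one index at every `v ∣ p`»), and the skeleton
has since proved it IN PIECES (road B: K2⁺-e away from `(p)`, `μ`-monotonicity (B1), the residue at degree `p` (B1c), residual `GL(1)`
finiteness (B3) ⟸ [Unr] ∧ [Even]). After lam-a g19–g21's chain (Greenberg's Lemma 5.9 ⟸ FW, p717721; the [Even] plug p721873) and
the tree theorem `IwasawaTheory.classicalMuVanishes_finite_unramifiedClasses_holds` (Iwasawa's `μ = 0` in character form, p694611), the
ONLY print input left on road B is the Ferrero–Washington theorem. This file records that fact as ONE theorem per stage: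

* `gl1InputUnramified_of_ferreroWashington` — [Unr] ⟸ FW (U is a tree theorem);
* `residualGL1FinitenessOdd_of_ferreroWashington` — (B3) ⟸ FW;
* `kerSelmerMapFiniteOfDegreeP_of_ferreroWashington` — (B1c)'s output: finite Selmer kernel along every `ℚ`-isogeny of degree `p` ⟸ FW;
* **`xGrCharIdealIsogenyInvariantCyc_of_ferreroWashington`** — **K2⁺ ⟸ FW**.

Every proof is a composition BY NAME of tree theorems (`UnrTransport.gl1InputUnramified_of_ferreroWashington`,
`residualGL1FinitenessOdd_of_unr_even'`, `EvenTransport.greenbergEvenInput_of_ferreroWashington`, `stub_roadBResidueP`,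
`xGrCharIdealIsogenyInvariantCyc_of_kerSelmerMapFiniteOfDegreeP`); the mathematics is the ideator bsd-idea-11's (g6–g17), the LEAD
cruxlead-19035 g0's workers' and lam-a g19–g20's. CONDITIONAL on FW (`IwasawaTheory.ferreroWashington1979_classicalMuVanishes`, Ann. of
Math. 109 (1979), a refereed theorem carried as a named fact, size XL). HONEST FRAMING: conditional helper theorems; nothing about BSD,
Mazur's main conjecture or IMC2 is asserted; 0 cells / labels / tiers move.
[cite: PerrinRiou1989ASPM, Théorème (p. 349)] [cite: KobayashiOta2020, Prop. 2.9 (proof, footnote 1 p. 552)]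
[cite: GreenbergLNM1716, §5 Lemma 5.9, Prop. 5.10 (proof)] [cite: FerreroWashington1979, Theorem] [cite: Washington1997, §7.5 Thm. 7.15, §13.5]
-/

noncomputable section

set_option linter.dupNamespace false
set_option autoImplicit false

open scoped NumberField Pointwise
open Field IsDedekindDomain
open Literature.NumberTheory.GaloisRepresentations
open Literature.NumberTheory.EllipticCurves Literature.NumberTheory.EllipticCurves.GreenbergSelmer
open Literature.NumberTheory.EllipticCurves.GreenbergVatsal2000
open Literature.NumberTheory.IwasawaTheory

namespace Summit.BirchSwinnertonDyer.BirchSwinnertonDyer.Theorems.InterludeWithTorsion.RoadBOfFW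

/-- **[Unr] from Ferrero–Washington alone**: the everywhere-unramified classes of `H¹(K_∞⁺, M)` are finite for an order-`p` `M` with
`Γ_ℚ`-provenance over the cyclotomic tower of an imaginary quadratic `K` (`RoadBHelpers.GL1InputUnramified`) — the tree theorem
`UnrTransport.gl1InputUnramified_of_ferreroWashington` (trivialising abelian field `F = K·ℚ(η)`, FW for `F`, transport) with its second
input, Iwasawa's «`μ = 0` ⟹ finitely many unramified classes», supplied by the tree theorem
`IwasawaTheory.classicalMuVanishes_finite_unramifiedClasses_holds`. [cite: FerreroWashington1979, Theorem]
[cite: Washington1997, §13.5 (Prop. 13.28)] [cite: GreenbergLNM1716, §5, proof of Prop. 5.10] -/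
theorem gl1InputUnramified_of_ferreroWashington (hFW : ferreroWashington1979_classicalMuVanishes) :
    RoadBHelpers.GL1InputUnramified :=
  UnrTransport.gl1InputUnramified_of_ferreroWashington hFW
    Literature.NumberTheory.IwasawaTheory.classicalMuVanishes_finite_unramifiedClasses_holds

/-- **(B3) `ResidualGL1FinitenessOdd` from Ferrero–Washington alone**: the residual Greenberg Selmer group (relaxed above `v`, zero above
`v̄`, unramified outside `S`) of an order-`p` `Γ_ℚ`-character over the cyclotomic tower of an imaginary quadratic `K` with `p = v v̄` odd is
finite — W2's swap assembly `residualGL1FinitenessOdd_of_unr_even'` fed by [Unr] (previous theorem, through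
`RoadBHelpers.mem_everywhereUnramified_iff`) and [Even] (`EvenTransport.greenbergEvenInput_of_ferreroWashington`: Greenberg's Lemma 5.9
⟸ FW, p717721/p721873). [cite: GreenbergLNM1716, §5 Lemma 5.9 and proof of Prop. 5.10] [cite: FerreroWashington1979, Theorem] -/
theorem residualGL1FinitenessOdd_of_ferreroWashington (hFW : ferreroWashington1979_classicalMuVanishes) :
    ResidualGL1FinitenessOdd :=
  residualGL1FinitenessOdd_of_unr_even'
    (fun K _ _ hK p _ hp2 κ hκ M _ _ _ _ _ hcard hprov ↦ by
      have h := gl1InputUnramified_of_ferreroWashington hFW K hK p hp2 κ hκ M hcard hprov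
      refine h.subset ?_
      intro c hc
      exact (RoadBHelpers.mem_everywhereUnramified_iff (H := κ.kerSubgroup) (M := M) c).2 hc)
    (EvenTransport.greenbergEvenInput_of_ferreroWashington hFW)

/-- **(B1c)'s output from Ferrero–Washington alone**: along every `ℚ`-isogeny `ψ₀ : W → W'` of degree exactly `p` between curves with good
reduction at the odd prime `p = v v̄`, the map of Greenberg Selmer groups `Sel_{v̄}(K_∞⁺, ψ₀/K)` over the cyclotomic tower has FINITE kernel
(`KerSelmerMapFiniteOfDegreeP`) — the tree theorem `stub_roadBResidueP : ResidualGL1FinitenessOdd → KerSelmerMapFiniteOfDegreeP`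
(p687195) applied to the previous theorem. [cite: GreenbergLNM1716, §5, proof of Prop. 5.10] [cite: GreenbergVatsal2000, §2 Prop. 2.8] -/
theorem kerSelmerMapFiniteOfDegreeP_of_ferreroWashington (hFW : ferreroWashington1979_classicalMuVanishes) :
    KerSelmerMapFiniteOfDegreeP :=
  stub_roadBResidueP (residualGL1FinitenessOdd_of_ferreroWashington hFW)

/-- **K2⁺ FROM FERRERO–WASHINGTON ALONE.** For rationally isogenous elliptic curves `W₁ ∼ W₂` over `ℚ` (globally minimal models), an odd
prime `p` of good reduction for `W₁`, an imaginary quadratic `K` (Heegner for `N_{W₁}` and for `p`, `d_K` odd, `d_K ≠ −3`) with `p = v v̄`,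
the CYCLOTOMIC `ℤ_p`-extension `κ` of `K` and a topological generator `γ`: if `𝔛_Gr(W₁/K_∞⁺) = AcSelmer.XAc (W₁/K) p κ v̄ ∅ γ` is
`Λ`-torsion then so is `𝔛_Gr(W₂/K_∞⁺)`, and the two characteristic ideals are EQUAL (`XGrCharIdealIsogenyInvariantCyc`, the line's K2⁺ —
Perrin-Riou's `μ`-formula / Kobayashi–Ota Prop. 2.9 on the cyclotomic line, whose typing as a named fact was refused, p617858) — GRANTED
ONLY the Ferrero–Washington theorem: the tree theorem `xGrCharIdealIsogenyInvariantCyc_of_kerSelmerMapFiniteOfDegreeP` (K2⁺-e away from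
`(p)` + `μ`-monotonicity + reduction to prime-degree steps) applied to the previous theorem. CONDITIONAL on FW; nothing about BSD, Mazur's
main conjecture or IMC2 is asserted. [cite: PerrinRiou1989ASPM, Théorème (p. 349)] [cite: KobayashiOta2020, Prop. 2.9 (proof, footnote 1 p. 552)]
[cite: GreenbergLNM1716, §1 (before Conj. 1.11), §5 Lemma 5.9, Prop. 5.10] [cite: FerreroWashington1979, Theorem] -/
theorem xGrCharIdealIsogenyInvariantCyc_of_ferreroWashington (hFW : ferreroWashington1979_classicalMuVanishes) :
    XGrCharIdealIsogenyInvariantCyc :=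
  xGrCharIdealIsogenyInvariantCyc_of_kerSelmerMapFiniteOfDegreeP (kerSelmerMapFiniteOfDegreeP_of_ferreroWashington hFW)

end Summit.BirchSwinnertonDyer.BirchSwinnertonDyer.Theorems.InterludeWithTorsion.RoadBOfFW

end
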